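import Mathlib
import HarnessLib
import Literature.Probability.LatticeModels.TriangularLatticeProofs
import Literature.Probability.RandomPlanarGeometry.CardyFunction

/-!
# Crux `SegmentOpen` (stmt-CriticalPhenomena-5471), line `Sketch` — stub `stub_order1Rigidity` (O1)

Lead c6's census stub O1, ORDER-1 RIGIDITY OF THE JET IDENTIFICATION (registered verbatim).
Pure one-variable calculus; no percolation object is mentioned.

Setting.  `α : ℝ → ℂ` is a modulus curve, real-analytic on `[0,1]`, running on the unit circle
(`‖α t‖ = 1` on `[0,1]`) and starting at Smirnov's modulus `α 0 = ζ = e^{iπ/3}`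
(`LatticeModels.triZeta`).  `M : ℂ → ℝ` is a real-analytic "modulus function" on the upper
half-plane with `M ζ ∈ (0,1)`, `F = RandomPlanarGeometry.cardyFunction` (real-analytic on `(0,1)`),
and `a : ℕ → ℝ` is a coefficient sequence with `Σ_k a k s^k = F (M (α s))` for `0 ≤ s < ε`.

Claim.  There is ONE real constant `c`, depending on `α` only, such that for all such `M, a, ε`
`a 1 = c · d/dθ F(M(e^{iθ}))|_{θ = π/3}`.

Proof.
* `Order1Rigidity.hasDerivWithinAt_of_hasSum`: the series `Σ a k s^k` converges at `s = ε/2`, so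
  the formal power series `ofScalars ℝ a` has radius `≥ ε/2`; its sum `g` is analytic at `0` with
  `g' (0) = a 1` (`HasFPowerSeriesAt.hasDerivAt`) and agrees with `h s = F (M (α s))` on `[0, ε/2)`,
  so `h` has right derivative `a 1` at `0`.
* `Order1Rigidity.exists_deriv_eq_smul`: `t ↦ ‖α t‖²` is constant `= 1` on `[0,1]`, so its right
  derivative `2 ⟪α 0, α' 0⟫` at `0` vanishes (uniqueness of one-sided derivatives on `[0, ∞)`);
  with `α 0 = ζ = 1/2 + i√3/2` this forces `α' 0 = c • (i ζ)` with `c = 2 · im (α' 0)`.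
* Chain rule (`M` real-Fréchet-differentiable at `ζ`, `F` differentiable at `M ζ`): the two-sided
  derivative of `h` at `0` is `F'(M ζ) · DM_ζ (α' 0) = c · F'(M ζ) · DM_ζ (i ζ)`, and the latter
  factor is `d/dθ F(M(e^{iθ}))|_{π/3}` since `d/dθ e^{iθ} = i e^{iθ}` and `e^{iπ/3} = ζ`.
  Uniqueness of the right derivative at `0` identifies it with `a 1`.
-/

noncomputable section

namespace Summit.CriticalPhenomena.CardyFormulaZ2.Theorems

open Literature.Probability
open Filter Set Topology
open scoped NNReal ENNReal

namespace Order1Rigidity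

/-- **One-sided jets, order 1.**  If `Σ_k a k s^k = h s` for all `0 ≤ s < ε` (`ε > 0`), then `h`
has right derivative `a 1` at `0`. -/
theorem hasDerivWithinAt_of_hasSum {a : ℕ → ℝ} {h : ℝ → ℝ} {ε : ℝ} (hε : 0 < ε)
    (hsum : ∀ s : ℝ, 0 ≤ s → s < ε → HasSum (fun k : ℕ => a k * s ^ k) (h s)) :
    HasDerivWithinAt h (a 1) (Set.Ici 0) 0 := by
  have hε2 : 0 < ε / 2 := half_pos hε
  -- the formal power series with coefficients `a` has radius `≥ ε / 2`
  let p : FormalMultilinearSeries ℝ ℝ ℝ := FormalMultilinearSeries.ofScalars ℝ a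
  let r : ℝ≥0 := ⟨ε / 2, hε2.le⟩
  have hr : (r : ℝ) = ε / 2 := rfl
  have ht : Tendsto (fun n => ‖p n‖ * (r : ℝ) ^ n) atTop (𝓝 0) := by
    have h1 := ((hsum (ε / 2) hε2.le (half_lt_self hε)).summable.tendsto_atTop_zero).norm
    rw [norm_zero] at h1
    refine h1.congr fun n => ?_
    rw [norm_mul, norm_pow, Real.norm_of_nonneg hε2.le, hr, FormalMultilinearSeries.ofScalars_norm]
  have hrad : (r : ℝ≥0∞) ≤ p.radius := p.le_radius_of_tendsto ht
  have hr0 : (0 : ℝ≥0∞) < r := ENNReal.coe_pos.2 (NNReal.coe_pos.1 (hr ▸ hε2))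
  have hps : HasFPowerSeriesOnBall p.sum p 0 r :=
    (p.hasFPowerSeriesOnBall (hr0.trans_le hrad)).mono hr0 hrad
  -- its sum has derivative `a 1` at `0`
  have hd : HasDerivAt p.sum (a 1) 0 := by
    have h1 := hps.hasFPowerSeriesAt.hasDerivAt
    rwa [FormalMultilinearSeries.ofScalars_apply_eq, one_pow, smul_eq_mul, mul_one] at h1
  -- and agrees with `h` on `[0, ε / 2)`
  have heq : ∀ s : ℝ, 0 ≤ s → s < ε / 2 → h s = p.sum s := by
    intro s hs0 hs
    have hmem : s ∈ Metric.eball (0 : ℝ) r := by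
      rw [Metric.eball_coe, Metric.mem_ball, dist_zero_right, Real.norm_of_nonneg hs0, hr]
      exact hs
    have h1 := hps.hasSum hmem
    rw [zero_add] at h1
    simp only [p, FormalMultilinearSeries.ofScalars_apply_eq, smul_eq_mul] at h1
    exact (hsum s hs0 (hs.trans (half_lt_self hε))).unique h1
  refine hd.hasDerivWithinAt.congr_of_eventuallyEq ?_ (heq 0 le_rfl hε2)
  filter_upwards [Ico_mem_nhdsGE hε2] with s hs using heq s hs.1 hs.2

/-- `ζ = e^{iπ/3}` written as `exp (↑(π/3) · I)`. -/
theorem triZeta_eq_exp :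
    LatticeModels.triZeta = Complex.exp (↑(Real.pi / 3) * Complex.I) := by
  -- adapted from `Literature.Probability.LatticeModels.triZeta_eq`
  rw [LatticeModels.triZeta]; congr 1; push_cast; ring

/-- `d/dθ e^{iθ} = i ζ` at `θ = π/3`. -/
theorem hasDerivAt_exp_mul_I :
    HasDerivAt (fun θ : ℝ => Complex.exp (θ * Complex.I)) (Complex.I * LatticeModels.triZeta)
      (Real.pi / 3) := by
  have h := ((hasDerivAt_id' (Real.pi / 3)).ofReal_comp.mul_const Complex.I).cexp
  refine h.congr_deriv ?_
  rw [triZeta_eq_exp]; push_cast; ring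

/-- **Tangency to the unit circle at `ζ`.**  A curve `α` with `‖α t‖ = 1` on `[0,1]`, `α 0 = ζ`
and velocity `v` at `0` has `v = c • (i ζ)` for the real constant `c = 2 · im v`. -/
theorem exists_deriv_eq_smul {α : ℝ → ℂ} {v : ℂ} (hd : HasDerivAt α v 0)
    (hnorm : ∀ t ∈ Set.Icc (0 : ℝ) 1, ‖α t‖ = 1) (h0 : α 0 = LatticeModels.triZeta) :
    ∃ c : ℝ, v = c • (Complex.I * LatticeModels.triZeta) := by
  -- `d/dt ‖α t‖² = 2 ⟪α 0, v⟫` from the right at `0` ...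
  have h1 : HasDerivWithinAt (fun t => ‖α t‖ ^ 2) (2 * inner ℝ (α 0) v) (Set.Ici 0) 0 :=
    hd.norm_sq.hasDerivWithinAt
  -- ... and `‖α t‖² = 1` on `[0,1]`, so this right derivative vanishes
  have h2 : HasDerivWithinAt (fun t => ‖α t‖ ^ 2) 0 (Set.Ici 0) 0 := by
    refine (hasDerivWithinAt_const (0 : ℝ) (Set.Ici (0 : ℝ)) (1 : ℝ)).congr_of_eventuallyEq
      ?_ ?_
    · filter_upwards [Icc_mem_nhdsGE (zero_lt_one' ℝ)] with t ht
      rw [hnorm t ht, one_pow]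
    · rw [hnorm 0 ⟨le_rfl, zero_le_one⟩, one_pow]
  have h3 : 2 * inner ℝ (α 0) v = 0 := (uniqueDiffWithinAt_Ici (0 : ℝ)).eq_deriv _ h1 h2
  rw [h0, Complex.inner] at h3
  simp only [Complex.mul_re, Complex.conj_re, Complex.conj_im, LatticeModels.triZeta_re,
    LatticeModels.triZeta_im] at h3
  refine ⟨2 * v.im, Complex.ext ?_ ?_⟩
  · simp only [Complex.real_smul, Complex.mul_re, Complex.ofReal_re, Complex.ofReal_im,
      Complex.I_re, Complex.I_im, Complex.mul_im, LatticeModels.triZeta_re,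
      LatticeModels.triZeta_im]
    linarith
  · simp only [Complex.real_smul, Complex.mul_im, Complex.ofReal_re, Complex.ofReal_im,
      Complex.I_re, Complex.I_im, Complex.mul_re, LatticeModels.triZeta_re,
      LatticeModels.triZeta_im]
    ring

end Order1Rigidity

open Order1Rigidity in
/-- **O1 — ORDER-1 RIGIDITY OF THE JET IDENTIFICATION** (census stub of line `Sketch`, lead c6;
classical one-variable calculus).  For a modulus curve `α`, real-analytic on `[0,1]`, running on
the unit circle (`‖α t‖ = 1`) and starting at Smirnov's modulus `α 0 = ζ = e^{iπ/3}`, there is ONE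
real constant `c` (namely `θ′(0)` where `α = e^{iθ}` near `0`, i.e. `α′(0) = c · iζ`) such that
for EVERY real-analytic `M` on `ℍ` with `M ζ ∈ (0,1)` and every coefficient sequence `a` whose
series sums to `F(M(α s))` for small `s ≥ 0`, the first coefficient is
`a 1 = c · d/dθ F(M(e^{iθ}))|_{θ = π/3}` (one-sided uniqueness of power series + chain rule +
`d/dt ‖α t‖² = 0`). -/
theorem stub_order1Rigidity :
    ∀ α : ℝ → ℂ, AnalyticOnNhd ℝ α (Set.Icc 0 1) → (∀ t ∈ Set.Icc (0 : ℝ) 1, ‖α t‖ = 1) →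
      α 0 = LatticeModels.triZeta →
      ∃ c : ℝ, ∀ M : ℂ → ℝ, AnalyticOnNhd ℝ M {β : ℂ | 0 < β.im} →
        M LatticeModels.triZeta ∈ Set.Ioo (0 : ℝ) 1 →
        ∀ (a : ℕ → ℝ) (ε : ℝ), 0 < ε →
          (∀ s : ℝ, 0 ≤ s → s < ε →
            HasSum (fun k : ℕ => a k * s ^ k) (RandomPlanarGeometry.cardyFunction (M (α s)))) →
          a 1 = c * deriv (fun θ : ℝ =>
            RandomPlanarGeometry.cardyFunction (M (Complex.exp (θ * Complex.I)))) (Real.pi / 3) := by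
  intro α hα hnorm h0
  -- the velocity of the modulus curve at `0` is tangent to the unit circle at `ζ`
  have hdα : HasDerivAt α (deriv α 0) 0 := (hα 0 ⟨le_rfl, zero_le_one⟩).differentiableAt.hasDerivAt
  obtain ⟨c, hc⟩ := exists_deriv_eq_smul hdα hnorm h0
  refine ⟨c, fun M hM hMζ a ε hε hsum => ?_⟩
  -- `F ∘ M` is real-Fréchet-differentiable at `ζ`
  have hζ : 0 < LatticeModels.triZeta.im := by rw [LatticeModels.triZeta_im]; positivity
  have hFM : HasFDerivAt (fun z : ℂ => RandomPlanarGeometry.cardyFunction (M z))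
      (deriv RandomPlanarGeometry.cardyFunction (M LatticeModels.triZeta) •
        fderiv ℝ M LatticeModels.triZeta) LatticeModels.triZeta :=
    (RandomPlanarGeometry.analyticOnNhd_cardyFunction_Ioo _ hMζ).differentiableAt.hasDerivAt
      |>.comp_hasFDerivAt _ (hM _ hζ).differentiableAt.hasFDerivAt
  -- chain rule along `α` at `s = 0` and one-sided uniqueness: `a 1 = F'(M ζ) · DM_ζ (α' 0)`
  have hs : HasDerivAt (fun s : ℝ => RandomPlanarGeometry.cardyFunction (M (α s)))
      ((deriv RandomPlanarGeometry.cardyFunction (M LatticeModels.triZeta) •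
        fderiv ℝ M LatticeModels.triZeta) (deriv α 0)) 0 :=
    hFM.comp_hasDerivAt_of_eq _ hdα h0.symm
  have ha1 := (uniqueDiffWithinAt_Ici (0 : ℝ)).eq_deriv _ (hasDerivWithinAt_of_hasSum hε hsum)
    hs.hasDerivWithinAt
  -- chain rule along `θ ↦ e^{iθ}` at `θ = π/3`
  have hθ : HasDerivAt
      (fun θ : ℝ => RandomPlanarGeometry.cardyFunction (M (Complex.exp (θ * Complex.I))))
      ((deriv RandomPlanarGeometry.cardyFunction (M LatticeModels.triZeta) •
        fderiv ℝ M LatticeModels.triZeta) (Complex.I * LatticeModels.triZeta)) (Real.pi / 3) :=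
    hFM.comp_hasDerivAt_of_eq _ hasDerivAt_exp_mul_I triZeta_eq_exp
  rw [hθ.deriv, ha1, hc, ContinuousLinearMap.map_smul, smul_eq_mul]

end Summit.CriticalPhenomena.CardyFormulaZ2.Theorems
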